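import Literature.MathematicalPhysics.QuantumLattice.SpinChainsAkltParentProofs
import Literature.MathematicalPhysics.QuantumLattice.MatrixProductStatesProofs
import Literature.MathematicalPhysics.QuantumLattice.FinDimSpectrumProofs
import HarnessLib

/-!
# Discharged fact: the AKLT valence-bond-solid state is a ground state of the AKLT ring

Trunk **T-QLATTICE**. Sibling proof file of
`Literature/MathematicalPhysics/QuantumLattice/SpinChains.lean` (next to
`SpinChainsAkltParentProofs.lean`, whose `parentHamiltonian_akltTensor_eq_akltRing_holds` it uses).
It discharges the named fact (`def X : Prop`, D-0014)

* `Literature.MathematicalPhysics.QuantumLattice.aklt_isGroundStateVector_akltVBS` —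
  for `2 ≤ L` the VBS / matrix product state `akltVBS L = (σ ↦ tr A^{σ₀} ⋯ A^{σ_{L-1}})` is a
  (nonzero) ground-state vector of the AKLT ring `H_AKLT = Σ_i (𝐒_i · 𝐒_{i+1} + ⅓ (𝐒_i · 𝐒_{i+1})²)`
  (`aklt_isGroundStateVector_akltVBS_holds`);

no statement or definition is introduced or changed (the file is theorem-only).

## Source

I. Affleck, T. Kennedy, E. H. Lieb, H. Tasaki, *Valence bond ground states in isotropic quantum
antiferromagnets*, Comm. Math. Phys. **115** (1988) 477–528, §2.1 "The Ground State", pp. 481–483: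
eq. (2.1) is the bond-spin-`2` projection
`P₂(𝐒_i + 𝐒_{i+1}) = ⅙ (𝐒_i·𝐒_{i+1})² + ½ 𝐒_i·𝐒_{i+1} + ⅓`, eq. (2.2) the Hamiltonian
`H = Σ_i H_i`, `H_i = P₂(𝐒_i + 𝐒_{i+1})` (the model (1.1), `Σ_i [𝐒_i·𝐒_{i+1} + ⅓ (𝐒_i·𝐒_{i+1})²]`,
is `2H - 2L/3`), followed by "Obviously `H ≥ 0`, so if we
could find a state `Ω` with `H_i Ω = 0` for all `i` then `Ω` would be a ground state" (p. 481); the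
valence-bond-solid state `Ω^{αβ}` is eq. (2.7) and "when `Ω^{αβ}` is restricted to sites `i` and
`i+1`, it has only spin `0` and `1`. Hence `H_i Ω^{αβ} = 0`, so `Ω^{αβ}` is a ground state of `H`"
(p. 482); p. 483: "We can also define the periodic extension of `H` in (2.2) by adding
`P₂(𝐒_1 + 𝐒_L)` to `H` … If `L` is odd then `Ω = Ω^{αβ} ε_{αβ}` is a ground state. If `L` is even
then `Ω = Ω^α_α` is a ground state" — on the ring the VBS state is the trace of the product of the
site matrices, i.e. the periodic matrix product state `akltVBS L = (σ ↦ tr A^{σ₀} ⋯ A^{σ_{L-1}})`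
of the AKLT tensor (Fannes–Nachtergaele–Werner, CMP **144** (1992), §7, pp. 485–486; the same
argument in MPS language is their §5, Def. 5.4, p. 468). Textbook account: Tasaki (2020) §7.1.2.

## Proof

With `H_par = parentHamiltonian L 2 akltTensor = Σ_i P₂(i,i+1)`:
(1) `H_par = ½ H_AKLT + (L/3) 𝟙` (`parentHamiltonian_akltTensor_eq_akltRing_holds` of
`SpinChainsAkltParentProofs.lean`), i.e. `H_AKLT = 2 H_par - (2L/3) 𝟙`;
(2) `H_par Ω = 0` (`parentHamiltonian_mulVec_mps_eq_zero_holds`, the MPS is annihilated by its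
parent Hamiltonian), so `H_AKLT Ω = -(2L/3) Ω`;
(3) `H_par ≥ 0` (`parentHamiltonian_posSemidef_holds`), so `H_AKLT + (2L/3) 𝟙 = 2 H_par ≥ 0`;
(4) `Ω ≠ 0`: the amplitude of the configuration `(+, -, 0, …, 0)` is
`tr (A⁺ A⁻ (A⁰)^{L-2}) = -s² (-t)^{L-2} ≠ 0` (`A⁺ = s σ⁺`, `A⁰ = -t σᶻ`, `A⁻ = -s σ⁻`,
`s² = 2/3`, `t² = 1/3`; `akltVBS_ne_zero`);
(5) for a Hermitian matrix `A` with `A - E ≥ 0` and an eigenvector `A ψ = E ψ`, `ψ ≠ 0`, the ground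
energy `inf spec A` equals `E` (`groundEnergy_eq_of_posSemidef_sub`), whence
`groundEnergy H_AKLT = -2L/3` and `Ω` is a ground-state vector.

## References

* I. Affleck, T. Kennedy, E. H. Lieb, H. Tasaki, Comm. Math. Phys. **115** (1988) 477–528,
  doi:10.1007/BF01218021, §2.1 pp. 481–484, eqs. (1.1), (2.1), (2.2), (2.7), (2.12).
  [AffleckEtAl1988]
* H. Tasaki, *Physics and Mathematics of Quantum Many-Body Systems*, Graduate Texts in Physics,
  Springer (2020), doi:10.1007/978-3-030-41265-4, §7.1.2. [Tasaki2020]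
* M. Fannes, B. Nachtergaele, R. F. Werner, Comm. Math. Phys. **144** (1992) 443–490,
  doi:10.1007/BF02099178, §5 Def. 5.4 (p. 468), §7 (pp. 485–486). [FannesNachtergaeleWernerCMP1992]
-/

noncomputable section

open Matrix Complex
open scoped Matrix.Norms.L2Operator ComplexOrder MatrixOrder

namespace Literature.MathematicalPhysics.QuantumLattice

section QLattice

/-! ### Ground energy from a positive shift and an eigenvector -/

/-- **Locating the ground energy.** If `A` is Hermitian, `A - E ≥ 0`, and `E` is an eigenvalue of
`A` (`A ψ = E ψ` with `ψ ≠ 0`), then `E` is the ground energy `inf spec A`: `E ∈ spec A` gives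
`E₀ ≤ E`, and `E ≤ spec A` (`algebraMap_le_iff_le_spectrum`) gives `E ≤ E₀ = ⨅ᵢ λᵢ`. This is the
form in which frustration-free ground states are recognised ("`H ≥ 0`, so if we could find a
state `Ω` with `H_i Ω = 0` for all `i` then `Ω` would be a ground state", AKLT (1988) p. 481;
Tasaki (2020) §7.1.2). [folklore] -/
theorem groundEnergy_eq_of_posSemidef_sub {n : Type*} [Fintype n] [DecidableEq n]
    {A : Matrix n n ℂ} (hA : A.IsHermitian) (E : ℝ)
    (hpsd : (A - algebraMap ℝ (Matrix n n ℂ) E).PosSemidef) {ψ : n → ℂ} (hψ0 : ψ ≠ 0)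
    (hψ : A *ᵥ ψ = (E : ℂ) • ψ) : A.groundEnergy = E := by
  have hle : algebraMap ℝ (Matrix n n ℂ) E ≤ A := Matrix.le_iff.2 hpsd
  rw [algebraMap_le_iff_le_spectrum (ha := hA.isSelfAdjoint)] at hle
  -- `E` is an eigenvalue, hence in the (real) spectrum
  have hE : E ∈ spectrum ℝ A := by
    rw [spectrum.mem_iff]
    intro hunit
    apply hψ0
    apply Matrix.mulVec_injective_iff_isUnit.2 hunit
    rw [mulVec_zero, sub_mulVec, hψ, Algebra.algebraMap_eq_smul_one, smul_mulVec, one_mulVec,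
      Complex.coe_smul, sub_self]
  haveI : Nonempty n := by
    by_contra h
    rw [not_nonempty_iff] at h
    exact hψ0 (funext fun i => isEmptyElim i)
  apply le_antisymm
  · rw [hA.spectrum_real_eq_range_eigenvalues] at hE
    obtain ⟨i, hi⟩ := hE
    rw [← hi]
    exact groundEnergy_le_eigenvalues hA i
  · rw [groundEnergy_eq_iInf_eigenvalues_holds hA]
    exact le_ciInf fun i => hle _ (hA.eigenvalues_mem_spectrum_real i)

/-! ### The VBS state is not the zero vector -/

/-- Powers of a diagonal `2 × 2` matrix. [folklore] -/
theorem diag_fin_two_pow (a b : ℂ) (m : ℕ) :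
    (!![a, 0; 0, b] : Matrix (Fin 2) (Fin 2) ℂ) ^ m = !![a ^ m, 0; 0, b ^ m] := by
  induction m with
  | zero => rw [pow_zero, pow_zero, pow_zero, Matrix.one_fin_two]
  | succ m ih =>
    rw [pow_succ, ih, Matrix.mul_fin_two]
    congr <;> simp [pow_succ]

/-- **The AKLT valence-bond-solid state on the ring is nonzero** (`2 ≤ L`): the amplitude of the
configuration `(+, -, 0, …, 0)` (physical indices `(0, 2, 1, …, 1)`) is
`tr (A⁺ A⁻ (A⁰)^{L-2}) = -s² (-t)^{L-2} ≠ 0`, where `A⁺ = s σ⁺`, `A⁰ = -t σᶻ`, `A⁻ = -s σ⁻`,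
`s² = 2/3`, `t² = 1/3` (`akltTensor_eq_of_sq`). AKLT, CMP 115 (1988), §2.1, pp. 483–484 (the
nonzero coefficients `Ω(A)` of the VBS state, eq. (2.12), and Remark 1: "the four ground states are
nonzero"); Fannes–Nachtergaele–Werner (1992) §7. [cite: AffleckEtAl1988, §2.1 pp. 483–484] -/
theorem akltVBS_ne_zero (L : ℕ) [NeZero L] (hL : 2 ≤ L) : akltVBS L ≠ 0 := by
  obtain ⟨m, rfl⟩ : ∃ m, L = m + 2 := ⟨L - 2, by omega⟩
  obtain ⟨s, t, hs, ht, hA⟩ := akltTensor_eq_of_sq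
  have hs0 : s ≠ 0 := by
    rintro rfl
    norm_num at hs
  have ht0 : t ≠ 0 := by
    rintro rfl
    norm_num at ht
  -- the test configuration `(+, -, 0, …, 0)`
  set τ : Fin (m + 2) → Fin 3 := Fin.cons 0 (Fin.cons 2 fun _ => 1) with hτ
  intro h0
  have h1 := congrFun h0 (τ ∘ (ZMod.finEquiv (m + 2)).symm)
  change mpsPeriodic (m + 2) akltTensor ((τ ∘ (ZMod.finEquiv (m + 2)).symm) ∘
    ZMod.finEquiv (m + 2)) = 0 at h1
  have hcomp : (τ ∘ (ZMod.finEquiv (m + 2)).symm) ∘ ZMod.finEquiv (m + 2) = τ := by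
    funext i
    simp
  rw [hcomp, mpsPeriodic_apply, wordProduct, List.ofFn_succ, List.ofFn_succ, List.prod_cons,
    List.prod_cons] at h1
  simp only [hτ, Fin.cons_zero, Fin.cons_succ, List.ofFn_const, List.prod_replicate, hA,
    Matrix.cons_val_zero, Matrix.cons_val_one, Matrix.cons_val_two, Matrix.head_cons,
    Matrix.tail_cons] at h1
  rw [diag_fin_two_pow] at h1
  simp only [Matrix.mul_fin_two, Matrix.trace_fin_two, Matrix.of_apply, Matrix.cons_val',
    Matrix.cons_val_zero, Matrix.cons_val_one, Matrix.empty_val', Matrix.cons_val_fin_one] at h1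
  apply mul_ne_zero hs0 (mul_ne_zero (neg_ne_zero.2 hs0) (pow_ne_zero m (neg_ne_zero.2 ht0)))
  linear_combination h1

/-! ### Discharge of `aklt_isGroundStateVector_akltVBS` -/

/-- **Discharge of `aklt_isGroundStateVector_akltVBS` (AKLT: the valence-bond-solid state is a
ground state).** For `2 ≤ L` the VBS / matrix product state `Ω = akltVBS L` is a nonzero vector
with `H_AKLT Ω = E₀ Ω`, `E₀ = groundEnergy H_AKLT = -2L/3`: the parent Hamiltonian
`H_par = Σ_i P₂(i,i+1) = ½ H_AKLT + L/3` (`parentHamiltonian_akltTensor_eq_akltRing_holds`) is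
positive (`parentHamiltonian_posSemidef_holds`) and annihilates `Ω`
(`parentHamiltonian_mulVec_mps_eq_zero_holds`), so `H_AKLT Ω = -(2L/3) Ω` with
`H_AKLT + 2L/3 = 2 H_par ≥ 0`, and `Ω ≠ 0` (`akltVBS_ne_zero`); hence `-2L/3 = inf spec H_AKLT`
(`groundEnergy_eq_of_posSemidef_sub`). AKLT, CMP 115 (1988), §2.1, pp. 481–483 (eqs. (2.1), (2.2),
(2.7): `H = Σ_i P₂(𝐒_i + 𝐒_{i+1}) ≥ 0`, "`H_i Ω^{αβ} = 0`, so `Ω^{αβ}` is a ground state of `H`",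
and the periodic extension on p. 483); Tasaki (2020) §7.1.2; Fannes–Nachtergaele–Werner (1992)
§5 Def. 5.4 and §7. [cite: AffleckEtAl1988, §2.1 pp. 481–483, eqs. (2.1), (2.2), (2.7)] -/
theorem aklt_isGroundStateVector_akltVBS_holds : aklt_isGroundStateVector_akltVBS := by
  intro L _ hL
  have hpar0 : parentHamiltonian L 2 akltTensor *ᵥ akltVBS L = 0 :=
    parentHamiltonian_mulVec_mps_eq_zero_holds L 2 hL akltTensor
  have hpsd : (parentHamiltonian L 2 akltTensor).PosSemidef :=
    parentHamiltonian_posSemidef_holds L 2 akltTensor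
  -- `H_AKLT = 2 H_par - (2L/3) 𝟙`
  have hR : akltRing L =
      (2 : ℂ) • parentHamiltonian L 2 akltTensor -
        ((2 * (L : ℝ) / 3 : ℝ) : ℂ) • (1 : Op (ZMod L) 3) := by
    rw [parentHamiltonian_akltTensor_eq_akltRing_holds L hL, smul_add, smul_smul, smul_smul]
    push_cast
    module
  -- `H_AKLT Ω = -(2L/3) Ω`
  have hmul : akltRing L *ᵥ akltVBS L = ((-(2 * (L : ℝ) / 3) : ℝ) : ℂ) • akltVBS L := by
    rw [hR, sub_mulVec, smul_mulVec, hpar0, smul_zero, zero_sub, smul_mulVec, one_mulVec,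
      ← neg_smul]
    push_cast
    ring_nf
  -- `H_AKLT + (2L/3) 𝟙 = 2 H_par ≥ 0`
  have hshift : (akltRing L - algebraMap ℝ (Op (ZMod L) 3) (-(2 * (L : ℝ) / 3))).PosSemidef := by
    have h2 : akltRing L - algebraMap ℝ (Op (ZMod L) 3) (-(2 * (L : ℝ) / 3)) =
        parentHamiltonian L 2 akltTensor + parentHamiltonian L 2 akltTensor := by
      rw [hR, Algebra.algebraMap_eq_smul_one, ← Complex.coe_smul]
      push_cast
      module
    rw [h2]
    exact hpsd.add hpsd
  have hE : (akltRing L).groundEnergy = -(2 * (L : ℝ) / 3) :=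
    groundEnergy_eq_of_posSemidef_sub (akltRing_isHermitian L) _ hshift (akltVBS_ne_zero L hL) hmul
  refine ⟨akltVBS_ne_zero L hL, ?_⟩
  rw [hE]
  exact hmul

end QLattice

end Literature.MathematicalPhysics.QuantumLattice
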